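import Summits.Schanuel.Schanuel.Theorems.RootDecomp1KArcCell07

/-!
# RootDecomp1KArcCell — lens 1, generation 50, node 9 «THE ARC ENGINE: separation by positive-dimensional containment; members ρ° = Π(1+4^(−k!)) and the twin σ° = Π(1+2·4^(−k!)); item 33364 decided hyp-free at zA = (1, ℓ₂, ρ°), zD = (1, ρ°, σ°) and π-twins» — continuation (RootDecomp1KArcCell08): §8 position of ρ° relative to every decided class, by tree name

(lens-1 g50 HOME kernel K = HOME/decomp-schanuel-lens-1/g50/ArcCell.lean 10f1e0d5…, 3410 l · 258 decl lines, imports …RootDecomp1KCollarWall05 + …RootDecomp1KCommonRadixCell04 + …RootDecomp1KNWMeasureHolds BY NAME; P ArcCellProbe.lean af7624ff… rc 0 / C₀ ArcCellCtrl0.lean d71f613e… rc 0 / C ArcCellCtrl.lean 242a3b02… rc 1 = 42 planted; memo NODE-g50.md; CLAIM L2466, EX-ANTE PRICE + CHECKLIST K-g50 L2467, NODE L2469 / REQUEST L2470 (with the lens's ex-post self-correction: both members fall to printed dominance in substance — zA directly by Bundschuh LNM 1415 p.78 / Zhu 推论 1.3.3, zD after τ = σ°/ρ°²); critic VERDICT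 L2473: CLEARED AS PRICED EX ANTE — ONE CELL ×1 «ARC CELL (TYPED-LEVEL)» with the SUBSTANCE CAVEAT OF RECORD (both members inside the archimedean dominance class in substance; E2 convenient, not necessary), RULE K-R39 FIXED, PORT GO. Port by census-1 gen 21 as `RootDecomp1KArcCell01–13` along K's §1–§12 with §4, §7 and §12 cut at decl boundaries by the 400-line file cap: 01 = §1 (E1) `aeval_one_div_two_pow_ne_zero` (dyadic root lemma) + §2 (E2) `toPolyPoly`, `arc_count` (a relation contains ≤ deg q of an injective family of rational arcs — roots over the domain ℚ[X]); 02 = §3 (A) the member: `dfac`, `arcNum`, `arcProdQ` (ρ°_N), `sQ`, `rhoArc` (ρ° = Π(1 + 4^(−k!))) and its tails; 03 = §4a (E3) `TruncGenericSeq` («[class] definition» tag) + **`algebraicIndependent_of_truncGenericSeq`** (the g36/g37 extraction re-plumbed to arbitrary dyadic-type schedules); 04 = §4b `psQ`, the link `truncGeneric_iff_truncGenericSeq` and the tree (X′) re-derived — K's `theorem algebraicIndependent_liouville_of_truncGeneric'` DEMOTED to a documented `example` (its statement is byte-identical to the tree's `RootDecomp1KCommonRadixCell.algebraicIndependent_liouville_of_truncGeneric`,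 CommonRadixCell03 l.98 — dedup twin flagged by the writer L2472 (α), demotion pre-sanctioned by the critic L2473; nothing in K uses the primed name); 05 = §5 the arcs of ρ°: `arcPoly`, `arcF`, `arcBasis`, `arcScal`, `clearArc`, `truncGenericSeq_arc`, tightness `qArc` / `qArc_tight`; 06 = §6 the arc cell `algebraicIndependent_arc_of_mvPolyMeasure`, `algebraicIndependent_rhoArc_ell2`, walls `sb_arcWall3(_pi)`, item-shape instances + §7 head `zA` / `zApi`, `linearIndependent_zA(pi)`, `linLiouville_zA(pi)`; 07 = §7a the ONE 2-adic cut `cutA` + **`form_lower_bound_A`** (exponent 9), `not_hyperLinLiouville_zA(pi)` (m₀ = 10), `sb_zA(pi)`, `finiteOrderLiouvilleSchanuel_at_zA(pi)`, `item33364_at_zA(pi)`, `item31077_at_zA`; 08 = §8 `rhoArc_position` (11 conjuncts by tree name) and its lemmas, `liouville_rhoArc`; 09 = §9 (A′) the twin σ° = Π(1 + 2·4^(−k!)): `arcNum2`, `arcOdd2`, `arcProdQ2`, `sigmaArc`, `liouville_sigmaArc`; 10 = §10 the lines of (ρ°, σ°): `linPoly`, `linF`, `linBasis`, `linScal`, `clearLin`,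 `truncGenericSeq_lin`, `qLin` / `qLin_tight`; 11 = §11 the twin cell `algebraicIndependent_twin_of_mvPolyMeasure`, walls `sb_twinWall3(_pi)`, item-shape instances + §12 head `zD` / `zDpi`, binders; 12 = §12a part 1 the archimedean two-level cut `cutD`, `cutD_succ_ne_zero`, `cutD_height_bound`; 13 = §12a part 2 **`form_lower_bound_D`** (exponent 7), `not_hyperLinLiouville_zD(pi)` (m₀ = 8), `sb_zD(pi)`, `item33364_at_zD(pi)`, `zD_shape`. PORT EDITS (census convention): `set_option linter.dupNamespace false` dropped; 77 one-line helper docstrings added (statements quoted); per-part private helper copies; sections `Extraction` / `Members` / `TwinMembers` closed and re-opened across the cuts with their `variable` / `open` lines; statements and proofs otherwise verbatim (no renames; K's own private markers kept). `--supports stmt-Schanuel-33364`; no census credit carried; rung 0 — nothing here proves Schanuel; no ∀-item moves; 33364, 33363, 31077 stay OPEN.)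
-/

noncomputable section

open Polynomial LiouvilleNumber
open scoped Nat

namespace Summit.Schanuel.Schanuel.Theorems.RootDecomp1KArcCell

open Summit.Schanuel.Schanuel.Theorems.RootDecomp1KCollarCell
open Summit.Schanuel.Schanuel.Theorems.RootDecomp1KGapCell
open Summit.Schanuel.Schanuel.Theorems.RootDecomp1KTwoBaseCell
open Summit.Schanuel.Schanuel.Theorems.RootDecomp1KRelLiouvilleCell
open Summit.Schanuel.Schanuel.Theorems.RootDecomp1KNWMeasureHolds (polyMeasure_exp_one_holds)
open Summit.Schanuel.Schanuel.Theorems.RootDecomp1KHyper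
open Summit.Schanuel.Schanuel.Theorems.RootDecomp1KHyper.HyperCell
open Summit.Schanuel.Schanuel.Theorems.RootDecomp1KCommonRadixCell (TruncGeneric algebraicIndependent_liouville_of_truncGeneric)

/-! ## §8  POSITION of the member `ρ°` relative to EVERY decided `ρ`-class of the route's walls of record — BY TREE NAME

`ρ° = Π(1 + 4^{−k!})` is LIOUVILLE (Mathlib `Liouville`: the truncations `ρ°_N = ν_N/4^{D_N}` approximate to order
`4^{−(N+1)!} = den^{−(N+1)!/D_N}`), but its convergent denominators `4^{D_N} = 2^{2(0!+1!+⋯+N!)}` sit at NONE of the located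
heights of the decided classes: not at the skeleton points `2^{N!}` with Skel-quality (`¬ SkelLiouvilleFix m`, `m ≥ 1` — tree
SkelCell10; hence `¬ SkelLiouville`, `¬ LogLogLiouville`, `¬ LogSqLiouville`, `¬ LogHyperLiouville`, `¬ HyperLiouville`,
`¬ LiouvilleOrder k` (`k ≥ 1`) by the tree implications SkelCell01 / LogLogCell01 / DarkLogSq04 BY NAME), not in the factorial
GAPS (`¬ FactorialGapLiouville`, GapCell01), not in the dyadic COLLARS (`¬ DyadicCollarLiouville`, CollarCell02), and `ρ° > 3/2 ≥ ℓ_b`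
is no Liouville NUMBER `ℓ_b` (`b ≥ 2`, tree TwoBaseCell01 `liouvilleNumber_le`).  One covering inequality does all the work:
for a rational `r ≠ ρ°_N`, `|ρ° − r| ≥ 1/(den r · 2^{2D_N}) − 8/4^{(N+1)!}` (`rhoArc_sub_rat_lower`). -/
section Position

open Summit.Schanuel.Schanuel.Theorems.RootDecomp1KSkelCell
open Summit.Schanuel.Schanuel.Theorems.RootDecomp1KLogLogCell
open Summit.Schanuel.Schanuel.Theorems.RootDecomp1KGeneric (LogSqLiouville LiouvilleOrder)
open Summit.Schanuel.Schanuel.Theorems.RootDecomp1KDarkLogSq (logHyperLiouville_of_liouvilleOrder)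

/-- Two distinct rationals are `≥ 1/(den·den')` apart (private copy of the tree helper of GapCell01 / SkelCell03 / CollarCell05,
which is `private` there). -/
private theorem one_div_den_mul_den_le_abs_sub {s r : ℚ} (hne : s ≠ r) :
    1 / ((s.den : ℝ) * r.den) ≤ |(s : ℝ) - r| := by
  have hsd : (0 : ℝ) < s.den := by exact_mod_cast s.den_pos
  have hrd : (0 : ℝ) < r.den := by exact_mod_cast r.den_pos
  set z : ℤ := s.num * r.den - r.num * s.den with hz
  have hsub : (s : ℝ) - r = (z : ℝ) / ((s.den : ℝ) * r.den) := by
    rw [Rat.cast_def s, Rat.cast_def r, hz]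
    push_cast
    field_simp
  have hz0 : z ≠ 0 := by
    intro h0
    have : (s : ℝ) - r = 0 := by rw [hsub, h0]; simp
    exact hne (by exact_mod_cast (sub_eq_zero.mp this))
  have hz1 : (1 : ℝ) ≤ |(z : ℝ)| := by exact_mod_cast Int.one_le_abs hz0
  rw [hsub, abs_div, abs_of_pos (mul_pos hsd hrd)]
  exact div_le_div_of_nonneg_right hz1 (mul_pos hsd hrd).le

/-- **THE COVERING INEQUALITY.** For a rational `r ≠ ρ°_N`: `|ρ° − r| ≥ 1/(den r · 2^{2D_N}) − 8/4^{(N+1)!}`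
(`|r − ρ°_N| ≥ 1/(den r · den ρ°_N)`, `den ρ°_N = 2^{2D_N}`, and the tail window `ρ° − ρ°_N ≤ 8/4^{(N+1)!}`). -/
theorem rhoArc_sub_rat_lower (r : ℚ) (N : ℕ) (hne : r ≠ arcProdQ N) :
    1 / ((r.den : ℝ) * 2 ^ (2 * dfac N)) - 8 / 4 ^ (N + 1)! ≤ |rhoArc - r| := by
  have h1 := one_div_den_mul_den_le_abs_sub hne
  rw [den_arcProdQ_eq_two_pow] at h1
  push_cast at h1
  have h2 := rhoArc_sub_arcProdQ_le N
  have h3 : (0 : ℝ) ≤ rhoArc - arcProdQ N := by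
    have := rhoArc_sub_arcProdQ_ge N; have : (0 : ℝ) < 1 / 4 ^ (N + 1)! := by positivity
    linarith
  have htri : |(r : ℝ) - arcProdQ N| - |rhoArc - arcProdQ N| ≤ |rhoArc - r| := by
    have := abs_sub_abs_le_abs_sub ((r : ℝ) - arcProdQ N) (rhoArc - arcProdQ N)
    rw [show ((r : ℝ) - arcProdQ N) - (rhoArc - arcProdQ N) = -(rhoArc - r) by ring, abs_neg] at this
    exact this
  rw [abs_of_nonneg h3] at htri
  linarith

/-- **`ρ°` IS LIOUVILLE** (Mathlib `Liouville`): at `N = 2n+2`, `|ρ° − ν_N/4^{D_N}| ≤ 8/4^{(N+1)!} < (4^{D_N})^{−n}`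
(`n·D_N ≤ 2n·N!` and `2n·N! + 2 ≤ (2n+3)·N! = (N+1)!`). -/
theorem liouville_rhoArc : Liouville rhoArc := by
  intro n
  set N : ℕ := 2 * n + 2 with hN
  have hb1 : 1 < (4 : ℤ) ^ dfac N := by exact_mod_cast Nat.one_lt_pow (dfac_pos N).ne' (by norm_num : 1 < 4)
  have e : (((arcNum N : ℕ) : ℤ) : ℝ) / (((4 : ℤ) ^ dfac N : ℤ) : ℝ) = ((arcProdQ N : ℚ) : ℝ) := by
    rw [arcProdQ_eq_div]; push_cast; rfl
  refine ⟨(arcNum N : ℤ), (4 : ℤ) ^ dfac N, hb1, ?_, ?_⟩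
  · rw [e]; exact rhoArc_ne_arcProdQ N
  · rw [e, abs_of_nonneg (by linarith [arcProdQ_lt_rhoArc N])]
    refine (rhoArc_sub_arcProdQ_le N).trans_lt ?_
    push_cast
    have hexp1 : dfac N * n ≤ 2 * n * N ! := by have := dfac_le N; nlinarith
    have hexp2 : 2 * n * N ! + 2 ≤ (N + 1)! := by
      have h1 : (N + 1)! = (N + 1) * N ! := Nat.factorial_succ N
      have h2 : 1 ≤ N ! := Nat.factorial_pos N
      have h3 : (N + 1) * N ! = 2 * n * N ! + 3 * N ! := by rw [hN]; ring
      linarith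
    rw [div_lt_div_iff₀ (by positivity) (by positivity), one_mul, ← pow_mul]
    calc (8 : ℝ) * 4 ^ (dfac N * n) < 16 * 4 ^ (dfac N * n) := by
          have : (0 : ℝ) < 4 ^ (dfac N * n) := by positivity
          nlinarith
      _ ≤ 16 * 4 ^ (2 * n * N !) := by gcongr; norm_num
      _ = 4 ^ (2 * n * N ! + 2) := by rw [pow_add]; norm_num; ring
      _ ≤ 4 ^ (N + 1)! := pow_le_pow_right₀ (by norm_num) hexp2

/-- **`ρ° ∉ Skel₍₁₎`** (tree SkelCell10 `SkelLiouvilleFix 1`): a rational `r` with `den r = q > 2^{5!}` has scale `n = ι(q) ≥ 6`,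
`2^{(n−1)!} < q ≤ 2^{n!}`; with `N = n − 1`: either `r = ρ°_N` — then `|ρ° − r| ≥ 4^{−(N+1)!} ≥ q^{−(N+1)}` since
`(N+1)! ≤ (N+1)·D_N` — or `r ≠ ρ°_N` — then `|ρ° − r| ≥ 1/(q·2^{2D_N}) − 8/4^{(N+1)!} ≥ 1/(2q·2^{2D_N}) ≥ 1/(2q⁵) ≥ q^{−6} ≥ q^{−n}`
(`2^{2D_N} ≤ 2^{4N!} < q⁴`, `16·q·2^{2D_N} ≤ 2^{(N+1)!}·2^{(N+1)!}`). -/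
theorem not_skelLiouvilleFix_one_rhoArc : ¬ SkelLiouvilleFix 1 rhoArc := by
  intro h
  obtain ⟨r, hq₀, hne, hlt⟩ := h (2 ^ (5 : ℕ)! + 1)
  have hn : 5 < iota r.den := lt_iota_of_pow_lt (by omega)
  obtain ⟨N, hNdef⟩ : ∃ N, iota r.den = N + 1 := ⟨iota r.den - 1, by omega⟩
  have hN5 : 5 ≤ N := by omega
  have hqle : r.den ≤ 2 ^ (N + 1)! := by have := iota_spec r.den; rwa [hNdef] at this
  have hqgt : 2 ^ N ! < r.den := pow_lt_of_lt_iota (by omega)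
  rw [one_mul, hNdef] at hlt
  have hq1 : (1 : ℝ) ≤ r.den := by exact_mod_cast r.den_pos
  have hq2 : (2 : ℝ) ≤ r.den := by
    have : 2 ≤ r.den := le_trans (by norm_num [Nat.factorial]) hq₀
    exact_mod_cast this
  have hqR : (2 : ℝ) ^ N ! < r.den := by exact_mod_cast hqgt
  have hqleR : (r.den : ℝ) ≤ 2 ^ (N + 1)! := by exact_mod_cast hqle
  by_cases hr : r = arcProdQ N
  · -- case (a): `r = ρ°_N`, `q = 2^{2D_N}`
    subst hr
    have hge := rhoArc_sub_arcProdQ_ge N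
    have hqeq : (arcProdQ N).den = 2 ^ (2 * dfac N) := den_arcProdQ_eq_two_pow N
    have hexp : 2 * (N + 1)! ≤ 2 * dfac N * (N + 1) := by
      rw [Nat.factorial_succ]; have := factorial_le_dfac N; nlinarith
    have h1 : (1 : ℝ) / ((arcProdQ N).den : ℝ) ^ (N + 1) ≤ 1 / 4 ^ (N + 1)! := by
      rw [hqeq]; push_cast
      rw [← pow_mul, show (4 : ℝ) ^ (N + 1)! = 2 ^ (2 * (N + 1)!) by rw [pow_mul]; norm_num]
      exact one_div_le_one_div_of_le (by positivity) (pow_le_pow_right₀ (by norm_num) hexp)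
    rw [abs_of_nonneg (by linarith [arcProdQ_lt_rhoArc N])] at hlt
    linarith
  · -- case (b): any other rational
    have hlow := rhoArc_sub_rat_lower r N hr
    have hD : (2 : ℝ) ^ (2 * dfac N) ≤ (r.den : ℝ) ^ 4 := by
      calc (2 : ℝ) ^ (2 * dfac N) ≤ 2 ^ (4 * N !) := pow_le_pow_right₀ (by norm_num) (by have := dfac_le N; omega)
        _ = (2 ^ N !) ^ 4 := by rw [← pow_mul, mul_comm]
        _ ≤ (r.den : ℝ) ^ 4 := pow_le_pow_left₀ (by positivity) hqR.le _
    have hE : 2 * dfac N + 4 ≤ (N + 1)! := by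
      rw [Nat.factorial_succ]; have := dfac_le N; have : 4 ≤ N ! := (Nat.self_le_factorial N).trans' (by omega)
      nlinarith
    -- the tail is at most half the main term
    have hT : (8 : ℝ) / 4 ^ (N + 1)! ≤ 1 / ((r.den : ℝ) * 2 ^ (2 * dfac N)) / 2 := by
      have h4 : (4 : ℝ) ^ (N + 1)! = 2 ^ (N + 1)! * 2 ^ (N + 1)! := by rw [← mul_pow]; norm_num
      have h5 : (2 : ℝ) ^ (2 * dfac N + 4) ≤ 2 ^ (N + 1)! := pow_le_pow_right₀ (by norm_num) hE
      rw [pow_add] at h5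
      rw [div_div, div_le_div_iff₀ (by positivity) (by positivity), h4, one_mul]
      have h6 : (0 : ℝ) < 2 ^ (2 * dfac N) := by positivity
      nlinarith
    have h1 : 1 / (r.den : ℝ) ^ 5 ≤ 1 / ((r.den : ℝ) * 2 ^ (2 * dfac N)) := by
      apply one_div_le_one_div_of_le (by positivity)
      calc (r.den : ℝ) * 2 ^ (2 * dfac N) ≤ r.den * (r.den : ℝ) ^ 4 := by gcongr
        _ = (r.den : ℝ) ^ 5 := by ring
    have h2 : 1 / (r.den : ℝ) ^ 6 ≤ 1 / (r.den : ℝ) ^ 5 / 2 := by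
      rw [div_div]
      apply one_div_le_one_div_of_le (by positivity)
      have : (0 : ℝ) < (r.den : ℝ) ^ 5 := by positivity
      nlinarith
    have h3 : 1 / (r.den : ℝ) ^ (N + 1) ≤ 1 / (r.den : ℝ) ^ 6 :=
      one_div_le_one_div_of_le (by positivity) (pow_le_pow_right₀ hq1 (by omega))
    linarith

/-- `ρ° ∉ Skel₍ₘ₎` for every `m ≥ 1` (tree SkelCell10 `SkelLiouvilleFix.mono` BY NAME). -/
theorem not_skelLiouvilleFix_rhoArc {m : ℕ} (hm : 1 ≤ m) : ¬ SkelLiouvilleFix m rhoArc :=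
  fun h => not_skelLiouvilleFix_one_rhoArc (h.mono hm)

/-- `ρ° ∉ SkelLiouville` (tree SkelCell10 `skelLiouville_iff_fix`). -/
theorem not_skelLiouville_rhoArc : ¬ SkelLiouville rhoArc := fun h =>
  not_skelLiouvilleFix_one_rhoArc ((skelLiouville_iff_fix _).1 h 1)

/-- `ρ° ∉ LogLogLiouville` (tree SkelCell01 `logLogLiouville_skelLiouville`). -/
theorem not_logLogLiouville_rhoArc : ¬ LogLogLiouville rhoArc := fun h =>
  not_skelLiouville_rhoArc (logLogLiouville_skelLiouville h)

/-- `ρ° ∉ LogSqLiouville` (tree LogLogCell01 `logLogLiouville_of_logSqLiouville`). -/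
theorem not_logSqLiouville_rhoArc : ¬ LogSqLiouville rhoArc := fun h =>
  not_logLogLiouville_rhoArc (logLogLiouville_of_logSqLiouville h)

/-- `ρ° ∉ LogHyperLiouville` (tree LogLogCell01 `logLogLiouville_of_logHyperLiouville`). -/
theorem not_logHyperLiouville_rhoArc : ¬ LogHyperLiouville rhoArc := fun h =>
  not_logLogLiouville_rhoArc (logLogLiouville_of_logHyperLiouville h)

/-- `ρ° ∉ HyperLiouville` — the class of item 33363 (tree LogLogCell01 `logLogLiouville_of_hyperLiouville`). -/
theorem not_hyperLiouville_rhoArc : ¬ HyperLiouville rhoArc := fun h =>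
  not_logLogLiouville_rhoArc (logLogLiouville_of_hyperLiouville h)

/-- `ρ°` has NO finite Liouville order `k ≥ 1` (tree DarkLogSq04 `logHyperLiouville_of_liouvilleOrder`). -/
theorem not_liouvilleOrder_rhoArc {k : ℕ} (hk : 1 ≤ k) : ¬ LiouvilleOrder k rhoArc := fun h =>
  not_logHyperLiouville_rhoArc (logHyperLiouville_of_liouvilleOrder hk h)

/-- **`ρ° ∉ FactorialGapLiouville`** (tree GapCell01), refuted at quality `A = 6`: a gap approximant `r` at scale `N` has
`Q = den r > 2^{6N!} ≥ 2^{2D_N}` (so `r ≠ ρ°_N`) and `Q⁶ < 2^{(N+1)!}`; then `|ρ° − r| ≥ 1/(Q·2^{2D_N}) − 8/4^{(N+1)!} ≥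
1/Q² − 8/Q¹² ≥ 1/(2Q²) ≥ Q^{−6}`. -/
theorem not_factorialGapLiouville_rhoArc : ¬ FactorialGapLiouville rhoArc := by
  intro h
  obtain ⟨N, -, r, hd1, hd2, hlt⟩ := h 6 0
  have hq1 : (1 : ℝ) ≤ r.den := by exact_mod_cast r.den_pos
  have h2D : (2 : ℝ) ^ (2 * dfac N) < r.den :=
    lt_of_le_of_lt (pow_le_pow_right₀ (by norm_num) (by have := dfac_le N; omega)) hd1
  have hq2 : (2 : ℝ) ≤ r.den := by
    have : (2 : ℝ) ≤ 2 ^ (2 * dfac N) := by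
      calc (2 : ℝ) = 2 ^ 1 := by norm_num
        _ ≤ 2 ^ (2 * dfac N) := pow_le_pow_right₀ (by norm_num) (by have := dfac_pos N; omega)
    linarith
  have hne : r ≠ arcProdQ N := by
    intro hr
    rw [hr, den_arcProdQ_eq_two_pow] at h2D
    push_cast at h2D
    exact lt_irrefl _ h2D
  have hlow := rhoArc_sub_rat_lower r N hne
  have h1 : 1 / (r.den : ℝ) ^ 2 ≤ 1 / ((r.den : ℝ) * 2 ^ (2 * dfac N)) := by
    apply one_div_le_one_div_of_le (by positivity)
    rw [pow_two]; gcongr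
  have hT : (8 : ℝ) / 4 ^ (N + 1)! ≤ 1 / (r.den : ℝ) ^ 2 / 2 := by
    have h4 : (4 : ℝ) ^ (N + 1)! = 2 ^ (N + 1)! * 2 ^ (N + 1)! := by rw [← mul_pow]; norm_num
    have h6 : (r.den : ℝ) ^ 6 ≤ 2 ^ (N + 1)! := hd2.le
    rw [div_div, div_le_div_iff₀ (by positivity) (by positivity), h4, one_mul]
    have h7 : (r.den : ℝ) ^ 6 * (r.den : ℝ) ^ 6 ≤ 2 ^ (N + 1)! * 2 ^ (N + 1)! :=
      mul_le_mul h6 h6 (by positivity) (by positivity)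
    have h8 : (8 : ℝ) * ((r.den : ℝ) ^ 2 * 2) ≤ (r.den : ℝ) ^ 6 * (r.den : ℝ) ^ 6 := by
      have e : (r.den : ℝ) ^ 6 * (r.den : ℝ) ^ 6 = (r.den : ℝ) ^ 2 * (r.den : ℝ) ^ 10 := by ring
      have h10 : (16 : ℝ) ≤ (r.den : ℝ) ^ 10 := by
        calc (16 : ℝ) = 2 ^ 4 := by norm_num
          _ ≤ 2 ^ 10 := by norm_num
          _ ≤ (r.den : ℝ) ^ 10 := pow_le_pow_left₀ (by norm_num) hq2 10
      rw [e]
      have : (0 : ℝ) ≤ (r.den : ℝ) ^ 2 := by positivity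
      nlinarith
    linarith
  have h3 : 1 / (r.den : ℝ) ^ 6 ≤ 1 / (r.den : ℝ) ^ 2 / 2 := by
    rw [div_div]
    apply one_div_le_one_div_of_le (by positivity)
    have e : (r.den : ℝ) ^ 6 = (r.den : ℝ) ^ 2 * (r.den : ℝ) ^ 4 := by ring
    have h16 : (2 : ℝ) ≤ (r.den : ℝ) ^ 4 := by
      calc (2 : ℝ) ≤ 2 ^ 4 := by norm_num
        _ ≤ (r.den : ℝ) ^ 4 := pow_le_pow_left₀ (by norm_num) hq2 4
    rw [e]
    have : (0 : ℝ) ≤ (r.den : ℝ) ^ 2 := by positivity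
    nlinarith
  linarith

/-- **`ρ° ∉ DyadicCollarLiouville`** (tree CollarCell02 — the class of the g48/g49 collar walls), refuted at `A = 7, K = 3`: a collar
approximant `t` at scale `N ≥ 3` has `den t = 2^{N!+h}`, `7 ≤ h`, `7h ≤ N!`, so `N! + h < 2D_N` (hence `t ≠ ρ°_N`) and
`|ρ° − t| ≥ 2^{−(N!+h+2D_N)} − 8/4^{(N+1)!} ≥ 2^{−(N!+h+2D_N+1)} ≥ 2^{−7(N!+h)}`. -/
theorem not_dyadicCollarLiouville_rhoArc : ¬ DyadicCollarLiouville rhoArc := by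
  intro h
  obtain ⟨N, hN3, k, hk7, hkN, t, hden, hlt⟩ := h 7 3
  set E : ℕ := N ! + k with hE
  have hfac6 : 6 ≤ N ! := (Nat.factorial_le hN3).trans' (by norm_num [Nat.factorial])
  have hD := dfac_le N
  have hDN := factorial_le_dfac N
  have hkE : k < N ! := by omega
  have hne : t ≠ arcProdQ N := by
    intro ht
    have h1 := congrArg Rat.den ht
    rw [hden, den_arcProdQ_eq_two_pow] at h1
    have h2 := Nat.pow_right_injective (le_refl 2) h1
    omega
  have hlow := rhoArc_sub_rat_lower t N hne
  rw [hden] at hlow hlt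
  push_cast at hlow hlt
  rw [← pow_add] at hlow
  rw [← pow_mul] at hlt
  -- tail ≤ half the main term: `E + 2D_N + 4 ≤ 2(N+1)!`
  have hexp1 : N ! + k + 2 * dfac N + 4 ≤ (N + 1)! + (N + 1)! := by
    rw [Nat.factorial_succ]; nlinarith
  have hT : (8 : ℝ) / 4 ^ (N + 1)! ≤ 1 / (2 : ℝ) ^ (N ! + k + 2 * dfac N) / 2 := by
    have h4 : (4 : ℝ) ^ (N + 1)! = 2 ^ ((N + 1)! + (N + 1)!) := by rw [pow_add, ← mul_pow]; norm_num
    rw [h4, div_div, ← pow_succ, div_le_div_iff₀ (by positivity) (by positivity), one_mul,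
      show (8 : ℝ) = 2 ^ 3 by norm_num, ← pow_add]
    exact pow_le_pow_right₀ (by norm_num) (by omega)
  -- the claimed quality beats the main term: `E + 2D_N + 1 ≤ 7E`
  have hexp2 : N ! + k + 2 * dfac N + 1 ≤ (N ! + k) * 7 := by omega
  have h3 : 1 / (2 : ℝ) ^ ((N ! + k) * 7) ≤ 1 / (2 : ℝ) ^ (N ! + k + 2 * dfac N) / 2 := by
    rw [div_div, ← pow_succ]
    exact one_div_le_one_div_of_le (by positivity) (pow_le_pow_right₀ (by norm_num) hexp2)
  linarith

/-- `ρ°` is no Liouville NUMBER `ℓ_b = Σ b^{−k!}` (`b ≥ 2`): `ℓ_b ≤ 3/2 < ρ°` (tree TwoBaseCell01 `liouvilleNumber_le`). -/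
theorem rhoArc_ne_liouvilleNumber {b : ℕ} (hb : 2 ≤ b) : rhoArc ≠ liouvilleNumber b := by
  have h1 := liouvilleNumber_le (m := (b : ℝ)) (by exact_mod_cast hb)
  have h2 := three_halves_lt_rhoArc
  intro h; rw [h] at h2; linarith

/-- **POSITION of the member, BY TREE NAME:** `ρ°` is Liouville and lies in NONE of the decided `ρ`-classes of the route's
walls of record — not `Skel₍ₘ₎` for any `m ≥ 1` (SkelCell11 / CollarCell05), not Skel-Liouville (SkelCell07/11), not
factorial-gap (GapCell04), not dyadic-collar (CollarWall03/05), not log-log (LogLogCell08), not log-square (lens 6), not log-hyper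
(RelLiouvilleCell08), not hyper-Liouville (33363's class), of no finite Liouville order `k ≥ 1`, and no radix Liouville number
`ℓ_b` (TwoBaseCell / CommonRadixCell / LiouvilleBlockCell members). -/
theorem rhoArc_position :
    Liouville rhoArc ∧
    (∀ m : ℕ, 1 ≤ m → ¬ Summit.Schanuel.Schanuel.Theorems.RootDecomp1KSkelCell.SkelLiouvilleFix m rhoArc) ∧
    ¬ Summit.Schanuel.Schanuel.Theorems.RootDecomp1KSkelCell.SkelLiouville rhoArc ∧
    ¬ FactorialGapLiouville rhoArc ∧
    ¬ DyadicCollarLiouville rhoArc ∧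
    ¬ Summit.Schanuel.Schanuel.Theorems.RootDecomp1KLogLogCell.LogLogLiouville rhoArc ∧
    ¬ Summit.Schanuel.Schanuel.Theorems.RootDecomp1KGeneric.LogSqLiouville rhoArc ∧
    ¬ LogHyperLiouville rhoArc ∧
    ¬ HyperLiouville rhoArc ∧
    (∀ k : ℕ, 1 ≤ k → ¬ Summit.Schanuel.Schanuel.Theorems.RootDecomp1KGeneric.LiouvilleOrder k rhoArc) ∧
    (∀ b : ℕ, 2 ≤ b → rhoArc ≠ liouvilleNumber b) :=
  ⟨liouville_rhoArc, fun _ hm => not_skelLiouvilleFix_rhoArc hm, not_skelLiouville_rhoArc,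
    not_factorialGapLiouville_rhoArc, not_dyadicCollarLiouville_rhoArc, not_logLogLiouville_rhoArc,
    not_logSqLiouville_rhoArc, not_logHyperLiouville_rhoArc, not_hyperLiouville_rhoArc,
    fun _ hk => not_liouvilleOrder_rhoArc hk, fun _ hb => rhoArc_ne_liouvilleNumber hb⟩

end Position

end Summit.Schanuel.Schanuel.Theorems.RootDecomp1KArcCell

end
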